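import Literature.MathematicalPhysics.QuantumFieldTheory.Balaban1983to89.B6Ineq2110TwoScaleV1

/-!
# `Balaban1983to89.B6Ineq2109TwoScaleV1` — T. Bałaban, *Propagators and renormalization transformations for lattice gauge
# theories. II*, Commun. Math. Phys. **96** (1984) 223–250 [Balaban1984PropagatorsII], (2.109) p. 242: **`c₀‖Δ₀ω‖² ≤ ⟨ω, Δ′_jω⟩ ≤
# c₁‖Δ₀ω‖² ≤ γ₁‖ω‖²` FOR THE CONCRETE `Δ′_j = H′_j*Δ²H′_j` OF THE TWO-SCALE DATA `tsV1`**, `Δ₀` the unit-lattice Laplacian of the V1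
# calculus on `T^{(j)}` — by transport to r03's typed (2.109) (`…B6DeltaPrime2109Torus.ineq2109_lower/_upper/_top`) along the dictionary
# `Δ₀ω̃ = (laplace 1 ω)~`

statement-level skeleton of published theorems with citation tags; proofs where landed; nothing here is a claim about the Yang–Mills mass gap

PDF held: `paper:balaban1984-cmp96-propagators-rt-ii` (journal page = PDF page + 222; p. 242 [PDF 20] read AS IMAGE on the ×2 render
`run/shared/lean/pub/pub-balaban/b2b-balaban-ref1/pages/1984-cmp96-propagators-rt-II/…-p020-x2.png`, 2026-08-21).

PRINT (verbatim, p. 242).  *"From this we get an exponential decay of Δ′_j(y − y′) and the bound c₀‖Δ₀ω‖² ≤ ⟨ω, Δ′_jω⟩ ≤ c₁‖Δ₀ω‖² ≤ γ₁‖ω‖². (2.109)"*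

CITATION HEADER (lean-in-tree rule) — WHAT IS REPRODUCED.  Phase-2 file of the `lit-balaban` typed skeleton (HOME
`run/shared/lean/pub/lit-balaban/`), seat **p22 gen 11** (B6 fold owner r03, referee ref-4; lane = the Sect. C chain (2.95)–(2.147) on the
concrete two-scale data `tsV1`).  SKELETON row **B6.Eq2.108** ((2.108)–(2.109); decl of record r03's `…B6DeltaPrime2109Torus.ineq2109` for the TYPED
torus operator `dPOp`, untouched — THIS FILE is its model instance for the concrete `Δ′_j` of the V1 two-scale data).  IMPORTS BY NAME: r03's
`ineq2109_lower` / `ineq2109_upper` / `ineq2109_top` (any torus, any fine factor) and `B5Action121.LapS_mulVec`, the same seat's dictionary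
`…B6Ineq2110TwoScaleV1.inner_Dp_eq_dPOp` (`⟨ω, Δ′_jω⟩ = θ·Re⟨ω̃, dPOp ω̃⟩`), gen 9's `transportC_apply`, the V1 `LatticeFieldCalculus.laplace`.
THIS FILE:
* §1 the dictionary for `Δ₀`: `shift_eq_add_unitVec` / `unshift_eq_sub_unitVec` (the V1 steps `x ± e_μ` on `Site P j` ARE the torus steps of
  `Tor (Mk P j)`), **`LapS_transportC`**: `LapS (Mk P j) c ω̃ = (laplace c ω)~`, `re_star_LapS_one_transportC`: `‖Δ₀ω̃‖² = Σ_x |(Δ₀ω)(x)|²`;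
* §2 **`ineq2109_V1`**: `θ·c₀(d)·Σ_x|(Δ₀ω)(x)|² ≤ ⟨ω, Δ′_jω⟩ ≤ θ·c₁(d)·Σ_x|(Δ₀ω)(x)|²` for every `ω`, and `ineq2109_V1_top`: `θ·c₁(d)·Σ_x|(Δ₀ω)(x)|² ≤
  θ·γ₁(d)·‖ω‖²` (`θ = (c/L^j)⁴L^{jd}`, `Δ₀ = laplace 1`).
THEOREMS ONLY (no definition, no `def … : Prop` fact); standard axioms.  HONEST SCOPE: r03's d-only constants `c₀, c₁, γ₁` times the V1 normalisation
`θ`; `‖Δ₀ω‖²` rendered as the site sum `Σ_x|(laplace 1 ω)(x)|²` on `T^{(j)}`; finite tori of the V1 calculus, centred blocks (`L` odd); NOT summit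
progress.
-/

noncomputable section

open scoped InnerProductSpace Matrix ComplexConjugate

namespace Literature.MathematicalPhysics.QuantumFieldTheory.Balaban1983to89.B6Ineq2109TwoScaleV1

open LatticeFieldCalculus B5SectBStatements B5Eq117TorusCarriers B6SectCTwoScaleV1 B6SectCTwoScaleV1Lattice
open B5Prop11Plancherel (Tor unitVec)
open B5Action121 (LapS LapS_mulVec)
open B6Hprime2101 (c0_2109 c1_2109 gamma1_2109)
open B6Hprime2101TorusAlgebra (dPOp)
open B6DeltaPrime2109Torus (ineq2109_lower ineq2109_upper ineq2109_top)
open B6Hprime2101TwoScaleV1Torus (transportC_apply)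
open B6Ineq2110TwoScaleV1 (inner_Dp_eq_dPOp)

variable {P : Params} {j : ℕ}

/-! ## §1  The dictionary for the unit-lattice Laplacian `Δ₀` -/

/-- the V1 step `x + e_μ` on `Site P j` is the torus step of `Tor (Mk P j)` (`Site P j` IS `Tor (Mk P j)`). [cite: Balaban1984PropagatorsI, (1.1) p.18] -/
theorem shift_eq_add_unitVec (x : Tor (Mk P j)) (μ : Fin P.d) :
    @Eq (Tor (Mk P j)) (Site.shift (P := P) (j := j) x μ) (x + unitVec (Mk P j) μ) := by
  funext ν
  simp only [Pi.add_apply, unitVec, Site.shift]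
  by_cases hν : ν = μ
  · subst hν
    rw [Function.update_self, Pi.single_eq_same]
  · rw [Function.update_of_ne hν, Pi.single_eq_of_ne hν, add_zero]

/-- the V1 step `x − e_μ` on `Site P j` is the torus step of `Tor (Mk P j)`. [cite: Balaban1984PropagatorsI, (1.1) p.18] -/
theorem unshift_eq_sub_unitVec (x : Tor (Mk P j)) (μ : Fin P.d) :
    @Eq (Tor (Mk P j)) (Site.unshift (P := P) (j := j) x μ) (x - unitVec (Mk P j) μ) := by
  funext ν
  simp only [Pi.sub_apply, unitVec, Site.unshift]
  by_cases hν : ν = μ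
  · subst hν
    rw [Function.update_self, Pi.single_eq_same]
  · rw [Function.update_of_ne hν, Pi.single_eq_of_ne hν, sub_zero]

/-- **`Δ ω̃ = (Δω)~`**: r03's torus Laplacian `LapS (Mk P j) c` of the complexified unit-lattice field is the complexified V1 `laplace c ω`.
[cite: Balaban1984PropagatorsII, (2.109) p.242] -/
theorem LapS_transportC (c : ℝ) (f : SiteField P j ℝ) :
    LapS (Mk P j) (c : ℂ) *ᵥ cplxS (tSc f) = cplxS (tSc (laplace c f)) := by
  funext x
  rw [LapS_mulVec, transportC_apply]
  simp only [laplace, transportC_apply, Complex.conj_ofReal, smul_eq_mul, Complex.ofReal_sum, Complex.ofReal_mul, Complex.ofReal_sub,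
    Complex.ofReal_add, Complex.ofReal_pow]
  refine Finset.sum_congr rfl fun μ _ => ?_
  rw [← shift_eq_add_unitVec x μ, ← unshift_eq_sub_unitVec x μ]
  ring

/-- `‖Δ₀ω̃‖² = Σ_x|(Δ₀ω)(x)|²` (`Δ₀ = laplace 1`; the transport is an isometric reindexing). [cite: Balaban1984PropagatorsII, (2.109) p.242] -/
theorem re_star_LapS_one_transportC (f : SiteField P j ℝ) :
    (star (LapS (Mk P j) 1 *ᵥ cplxS (tSc f)) ⬝ᵥ (LapS (Mk P j) 1 *ᵥ cplxS (tSc f))).re = ∑ x : Site P j, laplace 1 f x ^ 2 := by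
  have h := LapS_transportC (1 : ℝ) f
  rw [Complex.ofReal_one] at h
  rw [h]
  simp only [dotProduct, Pi.star_apply, transportC_apply, Complex.star_def, Complex.conj_ofReal, ← Complex.ofReal_mul,
    ← Complex.ofReal_sum, Complex.ofReal_re]
  exact Finset.sum_congr rfl fun x _ => by ring

/-! ## §2  (2.109) for the concrete `Δ′_j` of the two-scale data -/

section V1

variable {c : ℝ} (hc : c ≠ 0) (Λ' : Finset (Site P (j + 1))) (w : CIdx j Λ' → ℝ)

/-- **(2.109) for the concrete `Δ′_j = H′_j*Δ²H′_j` of `tsV1`**: *"c₀‖Δ₀ω‖² ≤ ⟨ω, Δ′_jω⟩ ≤ c₁‖Δ₀ω‖²"* for every unit-lattice field `ω` on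
`T^{(j)}`, `Δ₀ = laplace 1`, constants `θ·c₀(d)`, `θ·c₁(d)`, `θ = (c/L^j)⁴L^{jd}` (r03's `ineq2109_lower/_upper` through the dictionaries
`inner_Dp_eq_dPOp` and `LapS_transportC`). [cite: Balaban1984PropagatorsII, (2.109) p.242] -/
theorem ineq2109_V1 (hj : j ≤ P.m + P.K) (ω : USite P j) :
    (c / (P.L : ℝ) ^ j) ^ 4 * ((P.L : ℝ) ^ j) ^ P.d * c0_2109 P.d * ∑ x : Site P j, laplace 1 (WithLp.ofLp ω) x ^ 2 ≤
        ⟪ω, (tsV1 hc Λ' w).Dp ω⟫_ℝ ∧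
      ⟪ω, (tsV1 hc Λ' w).Dp ω⟫_ℝ ≤
        (c / (P.L : ℝ) ^ j) ^ 4 * ((P.L : ℝ) ^ j) ^ P.d * c1_2109 P.d * ∑ x : Site P j, laplace 1 (WithLp.ofLp ω) x ^ 2 := by
  rw [inner_Dp_eq_dPOp hc Λ' w hj ω]
  have hθ : 0 ≤ (c / (P.L : ℝ) ^ j) ^ 4 * ((P.L : ℝ) ^ j) ^ P.d := by positivity
  have h1 := ineq2109_lower (Mk P j) (P.L ^ j) (cplxS (tSc (WithLp.ofLp ω)))
  have h2 := ineq2109_upper (Mk P j) (P.L ^ j) (cplxS (tSc (WithLp.ofLp ω)))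
  rw [re_star_LapS_one_transportC] at h1 h2
  constructor
  · calc _ = (c / (P.L : ℝ) ^ j) ^ 4 * ((P.L : ℝ) ^ j) ^ P.d * (c0_2109 P.d * ∑ x : Site P j, laplace 1 (WithLp.ofLp ω) x ^ 2) := by ring
      _ ≤ _ := mul_le_mul_of_nonneg_left h1 hθ
  · calc _ ≤ (c / (P.L : ℝ) ^ j) ^ 4 * ((P.L : ℝ) ^ j) ^ P.d * (c1_2109 P.d * ∑ x : Site P j, laplace 1 (WithLp.ofLp ω) x ^ 2) :=
          mul_le_mul_of_nonneg_left h2 hθ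
      _ = _ := by ring

omit hc in
/-- the last inequality of (2.109), `c₁‖Δ₀ω‖² ≤ γ₁‖ω‖²`, on the V1 unit torus (times `θ`): `Δ₀ = laplace 1` is bounded (r03's `ineq2109_top`).
[cite: Balaban1984PropagatorsII, (2.109) p.242] -/
theorem ineq2109_V1_top (ω : USite P j) :
    (c / (P.L : ℝ) ^ j) ^ 4 * ((P.L : ℝ) ^ j) ^ P.d * c1_2109 P.d * ∑ x : Site P j, laplace 1 (WithLp.ofLp ω) x ^ 2 ≤
      (c / (P.L : ℝ) ^ j) ^ 4 * ((P.L : ℝ) ^ j) ^ P.d * gamma1_2109 P.d * ‖ω‖ ^ 2 := by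
  have hθ : 0 ≤ (c / (P.L : ℝ) ^ j) ^ 4 * ((P.L : ℝ) ^ j) ^ P.d := by positivity
  have h := ineq2109_top (Mk P j) (cplxS (tSc (WithLp.ofLp ω)))
  have hn : (star (cplxS (tSc (WithLp.ofLp ω))) ⬝ᵥ cplxS (tSc (WithLp.ofLp ω))).re = ‖ω‖ ^ 2 := by
    rw [B5HkOpLandauMin.star_cplxS_dotProduct_cplxS, Complex.ofReal_re, ← real_inner_self_eq_norm_sq]
    rfl
  rw [re_star_LapS_one_transportC, hn] at h
  calc _ = (c / (P.L : ℝ) ^ j) ^ 4 * ((P.L : ℝ) ^ j) ^ P.d * (c1_2109 P.d * ∑ x : Site P j, laplace 1 (WithLp.ofLp ω) x ^ 2) := by ring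
    _ ≤ (c / (P.L : ℝ) ^ j) ^ 4 * ((P.L : ℝ) ^ j) ^ P.d * (gamma1_2109 P.d * ‖ω‖ ^ 2) := mul_le_mul_of_nonneg_left h hθ
    _ = _ := by ring

end V1

end Literature.MathematicalPhysics.QuantumFieldTheory.Balaban1983to89.B6Ineq2109TwoScaleV1

end
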